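import Literature.NumberTheory.ModularForms.Lemma49Minus8
import HarnessLib

/-!
# CKMRV Lemma 4.9 (4.16) for `𝒦₋^{(8)}`: the non-decaying part `𝒢₋^{(8)}` and the bound

Cohn–Kumar–Miller–Radchenko–Viazovska, arXiv:1902.05438, §4.4 (definition of `𝒢`) and Lemma 4.9
(4.16) with `n_{−,z} = 1`: `|((𝒦₋ − 𝒢₋)|^τ_4 γ)(τ,z)| ≤ C|e^{πiz}τ²z²/(Δ(τ)Δ(z)(j(τ)−j(z)))|`.

For rows `(1, R₂, R₄)` (`R = ψ|γ`), `N_R = minus8Kernel R·Δ(τ)Δ(z)(j(τ)−j(z))`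
`= c[−2𝔠E₄Δ(τ)·E₁₀𝓛(z) + 𝔠R₄Δ(τ)·E₈W(z) + (R₂E₁₄ − R₄E₄³)(τ)·h(z)]`, `h = E₈W − E₆(U² − V²)`,
whose constant term in `e^{πiz}` is `(Δ(τ)/2π)[R₄(τ) − 2E₄(τ)(πiz + log 16)]`; since
`1/(Δ(z)(j(τ)−j(z))) = −1 + O(e^{−2π Im z})`, the non-decaying part of `minus8Kernel R` is
**`𝒢_R(τ,z) = (1/2π)[2E₄(τ)(πiz + log 16) − R₄(τ)]`** (`minus8G`; degree `1` in `z`, no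
`e^{−2πiz}`-term: `𝒢^{(8)}_{−1,j,−} = 0`, `𝒢^{(8)}_{0,1,−} = iE₄`, `𝒢^{(8)}_{0,0,−} = (2 log 16·E₄ − ψ₄)/2π`).
PROVED: the multiplied-out identity `(minus8Kernel R − 𝒢_R)·ΔΔ(j−j) = M_R` off the poles, the
decomposition of `M_R` into products each carrying an `O(e^{−π Im z})` factor, and **(4.16) for
rows with `R₂, R₄ = O(|τ|)`** on half-planes, hence for `γ = I, T, TS` (`kernelMinus8_sub_G_bound_416`).

## References

* H. Cohn, A. Kumar, S. D. Miller, D. Radchenko, M. Viazovska, Ann. of Math. 196 (2022),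
  arXiv:1902.05438, §4.4, Lemma 4.9 (4.16). [CohnEtAl2019]
-/

noncomputable section

open Complex hiding I
open Filter Topology Asymptotics ModularForm SlashInvariantForm EisensteinSeries
open UpperHalfPlane hiding I
open Complex (I)
open scoped Real MatrixGroups ModularForm Manifold

namespace Literature.NumberTheory.ModularForms

open Literature.NumberTheory.EllipticCurves.ModularForms (kleinJ E₄_cube_eq_kleinJ_mul)

/-- `Λ(z) = πiz + log 16`. (Same as `lamLead` of `KernelBounds24Minus`; restated to keep imports light.)
[cite: CohnEtAl2019, §2.1.2 (2.10)] -/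
def lamLeadZ (z : ℍ) : ℂ := π * I * z + (Real.log 16 : ℝ)

/-- **`𝒢_R(τ,z) = (1/2π)[2E₄(τ)(πiz + log 16) − R₄(τ)]`** (`𝒢₋^{(8)} = minus8G ψ₄`). [cite: CohnEtAl2019, §4.4] -/
def minus8G (R4 : ℍ → ℂ) (τ z : ℍ) : ℂ := 1 / (2 * (π : ℂ)) * (2 * E₄ τ * lamLeadZ z - R4 τ)

/-- The multiplied-out remainder `M_R = N_R − 𝒢_R·Δ(τ)Δ(z)(j(τ)−j(z))`. [cite: CohnEtAl2019, Lemma 4.9 (proof)] -/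
def minus8M (R2 R4 : ℍ → ℂ) (τ z : ℍ) : ℂ :=
  1 / (2 * 1728 * (π : ℂ)) *
    (-2 * 1728 * E₄ τ * ModularForm.discriminant τ * (E10fun z * logLambda z)
      + R2 τ * E14fun τ * (E8fun z * thetaW z - E₆ z * (thetaU z ^ 2 - thetaV z ^ 2))
      + R4 τ * (1728 * ModularForm.discriminant τ - E₄ τ ^ 3) * (E8fun z * thetaW z)
      + R4 τ * E₄ τ ^ 3 * (E₆ z * (thetaU z ^ 2 - thetaV z ^ 2)))
  - minus8G R4 τ z * (E₄ τ ^ 3 * ModularForm.discriminant z - E₄ z ^ 3 * ModularForm.discriminant τ)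

/-- `minus8Kernel_sub_G_mul_eq` (auxiliary). [cite: CohnEtAl2019, Lemma 4.9 (proof)] -/
theorem minus8Kernel_sub_G_mul_eq (R2 R4 : ℍ → ℂ) (τ z : ℍ) (hJ : kleinJ τ - kleinJ z ≠ 0) :
    (minus8Kernel R2 R4 τ z - minus8G R4 τ z) *
      (ModularForm.discriminant τ * ModularForm.discriminant z * (kleinJ τ - kleinJ z)) = minus8M R2 R4 τ z := by
  have hΔz := ModularForm.discriminant_ne_zero z
  have hΔτ := ModularForm.discriminant_ne_zero τ
  have e1 : kleinJ τ = E₄ τ ^ 3 / ModularForm.discriminant τ := by rw [eq_div_iff hΔτ]; exact (E₄_cube_eq_kleinJ_mul τ).symm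
  have e2 : kleinJ z = E₄ z ^ 3 / ModularForm.discriminant z := by rw [eq_div_iff hΔz]; exact (E₄_cube_eq_kleinJ_mul z).symm
  simp only [minus8Kernel, minus8M, minus8G, psiTilde0, psiTilde2, psiTilde4, E14fun, f2fun, Pi.mul_apply, Pi.sub_apply, Pi.inv_apply]
  field_simp
  rw [e1, e2]
  field_simp
  ring

/-- `norm_minus8Kernel_sub_G_mul_le` (auxiliary). [cite: CohnEtAl2019, Lemma 4.9 (proof)] -/
theorem norm_minus8Kernel_sub_G_mul_le (R2 R4 : ℍ → ℂ) (τ z : ℍ) :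
    ‖(minus8Kernel R2 R4 τ z - minus8G R4 τ z) *
      (ModularForm.discriminant τ * ModularForm.discriminant z * (kleinJ τ - kleinJ z))‖ ≤ ‖minus8M R2 R4 τ z‖ := by
  by_cases hJ : kleinJ τ - kleinJ z = 0
  · rw [hJ]; simp
  · rw [minus8Kernel_sub_G_mul_eq R2 R4 τ z hJ]

/-- **Decomposition of `M_R`** (`c𝔠 = 1/2π`):
`M_R = (1/2π)[−2E₄Δ(τ)·(E₁₀(𝓛 − Λ) + Λ(E₁₀ − E₄³))(z) + R₄Δ(τ)·(E₈(W−1) + (E₈ − E₄³))(z)`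
`  − 2E₄⁴(τ)·Λ(z)Δ(z) + R₄E₄³(τ)·Δ(z)] + c(R₂E₁₄ − R₄E₄³)(τ)·(E₈W − E₆(U²−V²))(z)`.
[cite: CohnEtAl2019, Lemma 4.9 (proof)] -/
theorem minus8M_decomp (R2 R4 : ℍ → ℂ) (τ z : ℍ) : minus8M R2 R4 τ z =
    1 / (2 * (π : ℂ)) *
      ( -2 * (E₄ τ * ModularForm.discriminant τ) *
            (E10fun z * (logLambda z - lamLeadZ z) + lamLeadZ z * (E10fun z - E₄ z ^ 3))
        + R4 τ * ModularForm.discriminant τ * (E8fun z * (thetaW z - 1) + (E8fun z - E₄ z ^ 3))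
        - 2 * E₄ τ ^ 4 * (lamLeadZ z * ModularForm.discriminant z)
        + R4 τ * E₄ τ ^ 3 * ModularForm.discriminant z )
    + 1 / (2 * 1728 * (π : ℂ)) * ((R2 τ * E14fun τ - R4 τ * E₄ τ ^ 3) *
        (E8fun z * thetaW z - E₆ z * (thetaU z ^ 2 - thetaV z ^ 2))) := by
  have hπ : (π : ℂ) ≠ 0 := ofReal_ne_zero.2 Real.pi_ne_zero
  simp only [minus8M, minus8G]
  field_simp
  ring

/-- The `z`-side factors on half-planes: `Λ = O(|z|)`, `𝓛 − Λ = O(b)`, `E₁₀ − E₄³, E₈ − E₄³ = O(q) ⊂ O(b)`,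
`W − 1 = O(b)`, `E₈W − E₆(U²−V²) = O(b)`, and the products used in the decomposition, all `O(|z|e^{−π Im z})`.
[cite: CohnEtAl2019, Lemma 4.9 (proof)] -/
theorem zSide_minusG_isBigO {δ : ℝ} (hδ : 0 < δ) :
    ((fun z : ℍ => E10fun z * (logLambda z - lamLeadZ z) + lamLeadZ z * (E10fun z - E₄ z ^ 3)) =O[𝓟 (halfPlane δ)]
        fun z : ℍ => ‖(z : ℂ)‖ * expDecayHalf z) ∧
    ((fun z : ℍ => E8fun z * (thetaW z - 1) + (E8fun z - E₄ z ^ 3)) =O[𝓟 (halfPlane δ)] fun z : ℍ => ‖(z : ℂ)‖ * expDecayHalf z) ∧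
    ((fun z : ℍ => lamLeadZ z * ModularForm.discriminant z) =O[𝓟 (halfPlane δ)] fun z : ℍ => ‖(z : ℂ)‖ * expDecayHalf z) ∧
    ((ModularForm.discriminant : ℍ → ℂ) =O[𝓟 (halfPlane δ)] fun z : ℍ => ‖(z : ℂ)‖ * expDecayHalf z) ∧
    ((fun z : ℍ => E8fun z * thetaW z - E₆ z * (thetaU z ^ 2 - thetaV z ^ 2)) =O[𝓟 (halfPlane δ)] fun z : ℍ => ‖(z : ℂ)‖ * expDecayHalf z) := by
  obtain ⟨hU1, hW1, hVb, hUWb, hSb, hM1, _, _, _, _, _, _⟩ := halfPlane_isBigO_theta hδ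
  obtain ⟨h4, h6, _, hΔ, hE4, hE6, _, h1, hcoe, hq1⟩ := halfPlane_isBigO_basic hδ
  obtain ⟨_, _, _, _, _, _, _, _, z43, _, _⟩ := halfPlane_isBigO_factors hδ
  obtain ⟨⟨CW, hW⟩, _⟩ := (thetaUVW_uniform hδ).2
  obtain ⟨_, ⟨CM, hM⟩⟩ := logLambda_uniform hδ
  have hb0 : ∀ τ : ℍ, 0 ≤ expDecayHalf τ := fun τ => (expDecayHalf_pos τ).le
  have mk : ∀ {f : ℍ → ℂ} {g : ℍ → ℝ} (C : ℝ), (∀ τ : ℍ, δ ≤ τ.im → ‖f τ‖ ≤ C * g τ) → (∀ τ, 0 ≤ g τ) →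
      f =O[𝓟 (halfPlane δ)] g := by
    intro f g C h hg
    rw [isBigO_principal]
    exact ⟨C, fun τ hτ => by rw [Real.norm_of_nonneg (hg τ)]; exact h τ hτ⟩
  have hq : qhalf =O[𝓟 (halfPlane δ)] expDecayHalf := mk 1 (fun τ _ => by rw [norm_qhalf, one_mul]) hb0
  have hb1 : expDecayHalf =O[𝓟 (halfPlane δ)] fun _ : ℍ => (1 : ℝ) := by
    rw [isBigO_principal]; exact ⟨1, fun τ _ => by
      rw [Real.norm_of_nonneg (hb0 τ), norm_one, mul_one]; exact expDecayHalf_le_one τ⟩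
  have hqq1 : qhalf =O[𝓟 (halfPlane δ)] fun _ : ℍ => (1 : ℝ) := hq.trans hb1
  have pw1 : ∀ {m : ℕ}, 1 ≤ m → (fun τ => expDecayHalf τ ^ m) =O[𝓟 (halfPlane δ)] expDecayHalf := by
    intro m h
    rw [isBigO_principal]; exact ⟨1, fun τ _ => by
      rw [Real.norm_of_nonneg (pow_nonneg (hb0 τ) _), Real.norm_of_nonneg (hb0 τ), one_mul]
      calc expDecayHalf τ ^ m ≤ expDecayHalf τ ^ 1 := pow_le_pow_of_le_one (hb0 τ) (expDecayHalf_le_one τ) h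
        _ = expDecayHalf τ := pow_one _⟩
  -- `q = b² = O(b)`
  have hqb : expDecay =O[𝓟 (halfPlane δ)] expDecayHalf := by
    have := pw1 (m := 2) (by norm_num); exact this.congr_left fun τ => (expDecay_eq_sq τ).symm ▸ rfl
  have bb : ∀ {u v : ℍ → ℂ}, u =O[𝓟 (halfPlane δ)] (fun _ : ℍ => (1 : ℝ)) → v =O[𝓟 (halfPlane δ)] (fun _ : ℍ => (1 : ℝ)) →
      (fun τ => u τ * v τ) =O[𝓟 (halfPlane δ)] fun _ : ℍ => (1 : ℝ) := fun hu hv => by simpa using hu.mul hv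
  have hE8 : E8fun =O[𝓟 (halfPlane δ)] fun _ : ℍ => (1 : ℝ) := (bb hE4 hE4).congr_left fun z => by simp [E8fun]
  have hE10 : E10fun =O[𝓟 (halfPlane δ)] fun _ : ℍ => (1 : ℝ) := (bb hE4 hE6).congr_left fun z => by simp [E10fun]
  -- `W − 1`, `M − log 16 = 𝓛 − Λ` are `O(b)`
  have rW : (fun τ => thetaW τ - 1 + 8 * qhalf τ - 24 * qhalf τ ^ 2 + 32 * qhalf τ ^ 3) =O[𝓟 (halfPlane δ)] fun τ => expDecayHalf τ ^ 4 :=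
    mk CW hW fun τ => pow_nonneg (hb0 τ) 4
  have rM : (fun τ => logLambdaPer τ - (Real.log 16 : ℝ) + 8 * qhalf τ - 12 * qhalf τ ^ 2) =O[𝓟 (halfPlane δ)]
      fun τ => expDecayHalf τ ^ 3 := mk CM hM fun τ => pow_nonneg (hb0 τ) 3
  have hq2 : (fun τ => qhalf τ ^ 2) =O[𝓟 (halfPlane δ)] expDecayHalf := by simpa [sq] using hqq1.mul hq
  have hq3 : (fun τ => qhalf τ ^ 3) =O[𝓟 (halfPlane δ)] expDecayHalf := by simpa [pow_succ] using (bb hqq1 hqq1).mul hq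
  have hWm1 : (fun z => thetaW z - 1) =O[𝓟 (halfPlane δ)] expDecayHalf := by
    have := (((rW.trans (pw1 (by norm_num))).sub (hq.const_mul_left 8)).add (hq2.const_mul_left 24)).sub (hq3.const_mul_left 32)
    exact this.congr_left fun τ => by ring
  have hLΛ : (fun z => logLambda z - lamLeadZ z) =O[𝓟 (halfPlane δ)] expDecayHalf := by
    have := ((rM.trans (pw1 (by norm_num))).sub (hq.const_mul_left 8)).add (hq2.const_mul_left 12)
    exact this.congr_left fun τ => by simp only [logLambdaPer, lamLeadZ]; ring
  -- `E₁₀ − E₄³ = (E₁₀ − 1) − (E₄³ − 1)`, `E₈ − E₄³ = E₄²(1 − E₄)`: `O(q) ⊂ O(b)`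
  have h43 : (fun z : ℍ => E₄ z ^ 3 - 1) =O[𝓟 (halfPlane δ)] expDecay := z43
  have hE10m : (fun z : ℍ => E10fun z - 1) =O[𝓟 (halfPlane δ)] expDecay := by
    have h46 : (fun z : ℍ => (E₄ z - 1) * E₆ z) =O[𝓟 (halfPlane δ)] expDecay := by simpa using h4.mul hE6
    exact (h46.add h6).congr_left fun z => by simp only [E10fun, Pi.mul_apply]; ring
  have d1 : (fun z : ℍ => E10fun z - E₄ z ^ 3) =O[𝓟 (halfPlane δ)] expDecayHalf :=
    ((hE10m.sub h43).congr_left fun z => by ring).trans hqb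
  have d2 : (fun z : ℍ => E8fun z - E₄ z ^ 3) =O[𝓟 (halfPlane δ)] expDecayHalf := by
    have : (fun z : ℍ => E₄ z ^ 2 * (E₄ z - 1)) =O[𝓟 (halfPlane δ)] expDecay := by
      simpa [sq, mul_assoc] using (bb hE4 hE4).mul h4
    have t : (fun z : ℍ => -(E₄ z ^ 2 * (E₄ z - 1))) =O[𝓟 (halfPlane δ)] expDecay := this.neg_left
    exact (t.congr_left fun z => by simp only [E8fun, Pi.mul_apply]; ring).trans hqb
  -- `Λ = O(|z|)`
  have hΛ : lamLeadZ =O[𝓟 (halfPlane δ)] fun z : ℍ => ‖(z : ℂ)‖ := by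
    have t1 : (fun z : ℍ => (π * I * z : ℂ)) =O[𝓟 (halfPlane δ)] fun z : ℍ => ‖(z : ℂ)‖ := by simpa using hcoe.const_mul_left (π * I : ℂ)
    have t2 : (fun _ : ℍ => ((Real.log 16 : ℝ) : ℂ)) =O[𝓟 (halfPlane δ)] fun z : ℍ => ‖(z : ℂ)‖ := by
      simpa using h1.const_mul_left (((Real.log 16 : ℝ)) : ℂ)
    exact (t1.add t2).congr_left fun z => by simp [lamLeadZ]
  -- lift `O(b)` to `O(|z| b)`
  have up : ∀ {f : ℍ → ℂ}, f =O[𝓟 (halfPlane δ)] expDecayHalf → f =O[𝓟 (halfPlane δ)] fun z : ℍ => ‖(z : ℂ)‖ * expDecayHalf z := by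
    intro f hf
    simpa using h1.mul hf
  refine ⟨?_, ?_, ?_, up (hΔ.trans hqb), ?_⟩
  · have t1 : (fun z : ℍ => E10fun z * (logLambda z - lamLeadZ z)) =O[𝓟 (halfPlane δ)] expDecayHalf := by simpa using hE10.mul hLΛ
    exact (up t1).add (hΛ.mul d1)
  · have t1 : (fun z : ℍ => E8fun z * (thetaW z - 1)) =O[𝓟 (halfPlane δ)] expDecayHalf := by simpa using hE8.mul hWm1
    exact up (t1.add d2)
  · exact hΛ.mul (hΔ.trans hqb)
  · -- `E₈W − E₆(U² − V²) = E₈(W − 1) + (E₈ − E₄³) + (E₄³ − 1) − (E₆ − 1)(U²−V²) − ((U−1)(U+1) − V²)`… simpler: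
    -- `= E₈(W−1) + (E₈ − 1) − (E₆ − 1)(U² − V²) − (U − 1)(U + 1) + V²`
    have hU1' : (fun z => thetaU z - 1) =O[𝓟 (halfPlane δ)] expDecayHalf := by
      have := hUWb.add hWm1; exact this.congr_left fun z => by ring
    have hE8m : (fun z : ℍ => E8fun z - 1) =O[𝓟 (halfPlane δ)] expDecayHalf := by
      have : (fun z : ℍ => (E₄ z - 1) * (E₄ z + 1)) =O[𝓟 (halfPlane δ)] expDecay := by
        simpa using h4.mul (hE4.add (isBigO_const_const (1 : ℂ) one_ne_zero _))
      exact ((this.congr_left fun z => by simp only [E8fun, Pi.mul_apply]; ring).trans hqb)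
    have hV1 : thetaV =O[𝓟 (halfPlane δ)] fun _ : ℍ => (1 : ℝ) := hVb.trans hb1
    have t1 : (fun z : ℍ => E8fun z * (thetaW z - 1)) =O[𝓟 (halfPlane δ)] expDecayHalf := by simpa using hE8.mul hWm1
    have t3 : (fun z : ℍ => (E₆ z - 1) * (thetaU z ^ 2 - thetaV z ^ 2)) =O[𝓟 (halfPlane δ)] expDecayHalf := by
      have hb : (fun z => thetaU z ^ 2 - thetaV z ^ 2) =O[𝓟 (halfPlane δ)] fun _ : ℍ => (1 : ℝ) := by
        have := (bb hU1 hU1).sub (bb hV1 hV1); exact this.congr_left fun z => by ring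
      simpa using (h6.trans hqb).mul hb
    have t4 : (fun z => (thetaU z - 1) * (thetaU z + 1)) =O[𝓟 (halfPlane δ)] expDecayHalf := by
      simpa using hU1'.mul (hU1.add (isBigO_const_const (1 : ℂ) one_ne_zero _))
    have t5 : (fun z => thetaV z ^ 2) =O[𝓟 (halfPlane δ)] expDecayHalf := by simpa [sq] using hV1.mul hVb
    have := (((t1.add hE8m).sub t3).sub t4).add t5
    exact up (this.congr_left fun z => by ring)

/-- **Lemma 4.9 (4.16) for rows `(1, R₂, R₄)` with `R₂, R₄ = O(|τ|)`** (multiplied-out): on `Im τ, Im z ≥ δ`,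
`‖(minus8Kernel R − 𝒢_R)(τ,z)·Δ(τ)Δ(z)(j(τ)−j(z))‖ ≤ C|τ|²|z|²e^{−π Im z}`. [cite: CohnEtAl2019, Lemma 4.9 (4.16)] -/
theorem minus8Kernel_sub_G_bound_416 {δ : ℝ} (hδ : 0 < δ) {R2 R4 : ℍ → ℂ}
    (h2 : R2 =O[𝓟 (halfPlane δ)] fun τ : ℍ => ‖(τ : ℂ)‖) (h4 : R4 =O[𝓟 (halfPlane δ)] fun τ : ℍ => ‖(τ : ℂ)‖) :
    ∃ C : ℝ, ∀ τ z : ℍ, δ ≤ τ.im → δ ≤ z.im →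
      ‖(minus8Kernel R2 R4 τ z - minus8G R4 τ z) *
        (ModularForm.discriminant τ * ModularForm.discriminant z * (kleinJ τ - kleinJ z))‖
          ≤ C * (‖(τ : ℂ)‖ ^ 2 * ‖(z : ℂ)‖ ^ 2 * expDecayHalf z) := by
  obtain ⟨_, _, _, hΔ, hE4, hE6, _, h1, hcoe, hq1⟩ := halfPlane_isBigO_basic hδ
  obtain ⟨_, _, _, _, f5, _⟩ := halfPlane_isBigO_factors hδ
  obtain ⟨g1, g2, g3, g4, g5⟩ := zSide_minusG_isBigO hδ
  set F := 𝓟 (halfPlane δ ×ˢ halfPlane δ)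
  have bb : ∀ {u v : ℍ → ℂ}, u =O[𝓟 (halfPlane δ)] (fun _ : ℍ => (1 : ℝ)) → v =O[𝓟 (halfPlane δ)] (fun _ : ℍ => (1 : ℝ)) →
      (fun τ => u τ * v τ) =O[𝓟 (halfPlane δ)] fun _ : ℍ => (1 : ℝ) := fun hu hv => by simpa using hu.mul hv
  have hE4_3 : (fun τ : ℍ => E₄ τ ^ 3) =O[𝓟 (halfPlane δ)] fun _ : ℍ => (1 : ℝ) := by
    have h2' : (fun τ : ℍ => E₄ τ ^ 2) =O[𝓟 (halfPlane δ)] fun _ : ℍ => (1 : ℝ) := by simpa [sq] using bb hE4 hE4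
    simpa [pow_succ] using bb h2' hE4
  have hE4_4 : (fun τ : ℍ => E₄ τ ^ 4) =O[𝓟 (halfPlane δ)] fun _ : ℍ => (1 : ℝ) := by simpa [pow_succ] using bb hE4_3 hE4
  have hΔ1 : (ModularForm.discriminant : ℍ → ℂ) =O[𝓟 (halfPlane δ)] fun _ : ℍ => (1 : ℝ) := hΔ.trans hq1
  -- `τ`-side coefficients are `O(|τ|)`
  have a1 : (fun τ : ℍ => E₄ τ * ModularForm.discriminant τ) =O[𝓟 (halfPlane δ)] fun τ : ℍ => ‖(τ : ℂ)‖ := by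
    simpa using h1.mul (bb hE4 hΔ1)
  have a2 : (fun τ : ℍ => R4 τ * ModularForm.discriminant τ) =O[𝓟 (halfPlane δ)] fun τ : ℍ => ‖(τ : ℂ)‖ := by
    simpa using h4.mul hΔ1
  have a3 : (fun τ : ℍ => E₄ τ ^ 4) =O[𝓟 (halfPlane δ)] fun τ : ℍ => ‖(τ : ℂ)‖ := by simpa using h1.mul hE4_4
  have a4 : (fun τ : ℍ => R4 τ * E₄ τ ^ 3) =O[𝓟 (halfPlane δ)] fun τ : ℍ => ‖(τ : ℂ)‖ := by simpa using h4.mul hE4_3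
  have a5 : (fun τ : ℍ => R2 τ * E14fun τ - R4 τ * E₄ τ ^ 3) =O[𝓟 (halfPlane δ)] fun τ : ℍ => ‖(τ : ℂ)‖ := by
    have t1 : (fun τ : ℍ => R2 τ * E14fun τ) =O[𝓟 (halfPlane δ)] fun τ : ℍ => ‖(τ : ℂ)‖ := by simpa using h2.mul f5
    exact t1.sub a4
  have T : ∀ {a g : ℍ → ℂ}, a =O[𝓟 (halfPlane δ)] (fun τ : ℍ => ‖(τ : ℂ)‖) →
      g =O[𝓟 (halfPlane δ)] (fun z : ℍ => ‖(z : ℂ)‖ * expDecayHalf z) →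
      (fun p : ℍ × ℍ => a p.1 * g p.2) =O[F] fun p => ‖(p.1 : ℂ)‖ * (‖(p.2 : ℂ)‖ * expDecayHalf p.2) :=
    fun ha hg => (isBigO_fst_of_halfPlane ha).mul (isBigO_snd_of_halfPlane hg)
  have s1 := T a1 g1
  have s2 := T a2 g2
  have s3 := T a3 g3
  have s4 := T a4 g4
  have s5 := T a5 g5
  have total := (((((s1.const_mul_left (-2 : ℂ)).add s2).sub (s3.const_mul_left 2)).add s4).const_mul_left (1 / (2 * (π : ℂ)))).add
    (s5.const_mul_left (1 / (2 * 1728 * (π : ℂ))))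
  have hO : (fun p : ℍ × ℍ => minus8M R2 R4 p.1 p.2) =O[F] fun p => ‖(p.1 : ℂ)‖ * (‖(p.2 : ℂ)‖ * expDecayHalf p.2) := by
    refine total.congr_left fun p => ?_
    rw [minus8M_decomp]; ring
  obtain ⟨C, hC⟩ := isBigO_principal.1 hO
  refine ⟨|C| / δ ^ 2, fun τ z hτ hz => (norm_minus8Kernel_sub_G_mul_le R2 R4 τ z).trans ?_⟩
  have h := hC (τ, z) ⟨hτ, hz⟩
  have hb0 : 0 ≤ expDecayHalf z := (expDecayHalf_pos z).le
  have hX0 : 0 ≤ ‖(τ : ℂ)‖ * (‖(z : ℂ)‖ * expDecayHalf z) := mul_nonneg (norm_nonneg _) (mul_nonneg (norm_nonneg _) hb0)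
  rw [Real.norm_of_nonneg hX0] at h
  refine h.trans ?_
  have hτ1 : δ ≤ ‖(τ : ℂ)‖ := hτ.trans (im_le_norm_coe τ)
  have hz1 : δ ≤ ‖(z : ℂ)‖ := hz.trans (im_le_norm_coe z)
  have h1' : C * (‖(τ : ℂ)‖ * (‖(z : ℂ)‖ * expDecayHalf z)) ≤ |C| * (‖(τ : ℂ)‖ * (‖(z : ℂ)‖ * expDecayHalf z)) :=
    mul_le_mul_of_nonneg_right (le_abs_self C) hX0
  refine h1'.trans ?_
  rw [show |C| / δ ^ 2 * (‖(τ : ℂ)‖ ^ 2 * ‖(z : ℂ)‖ ^ 2 * expDecayHalf z) =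
    |C| * (‖(τ : ℂ)‖ * (‖(z : ℂ)‖ * expDecayHalf z)) * ((‖(τ : ℂ)‖ / δ) * (‖(z : ℂ)‖ / δ)) by field_simp]
  refine le_mul_of_one_le_right (mul_nonneg (abs_nonneg C) hX0) ?_
  have a : 1 ≤ ‖(τ : ℂ)‖ / δ := by rw [le_div_iff₀ hδ]; linarith
  have b : 1 ≤ ‖(z : ℂ)‖ / δ := by rw [le_div_iff₀ hδ]; linarith
  nlinarith

/-- **Lemma 4.9 (4.16) for `𝒦₋^{(8)}|₄γ`, `γ ∈ {I, T, TS}`** (multiplied-out; the rows of `(𝒦 − 𝒢)|γ` are `ψ|γ`):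
with `𝒢 = minus8G (ψ₄|₄γ)`. [cite: CohnEtAl2019, Lemma 4.9 (4.16)] -/
theorem kernelMinus8_sub_G_bound_416 {δ : ℝ} (hδ : 0 < δ) (γ : SL(2, ℤ))
    (hγ : γ = 1 ∨ γ = ModularGroup.T ∨ γ = ModularGroup.T * ModularGroup.S) :
    ∃ C : ℝ, ∀ τ z : ℍ, δ ≤ τ.im → δ ≤ z.im →
      ‖(((fun σ => kernelMinus8 σ z) ∣[(4 : ℤ)] γ) τ - minus8G (psi4 ∣[(4 : ℤ)] γ) τ z) *
        (ModularForm.discriminant τ * ModularForm.discriminant z * (kleinJ τ - kleinJ z))‖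
          ≤ C * (‖(τ : ℂ)‖ ^ 2 * ‖(z : ℂ)‖ ^ 2 * expDecayHalf z) := by
  obtain ⟨hψ4, hψ2, _, _, _, h4T, h4TS⟩ := halfPlane_isBigO_psi hδ
  obtain ⟨_, _, _, _, _, _, _, _, hxi2, _, hxi2S, _⟩ := halfPlane_isBigO_theta hδ
  obtain ⟨_, _, _, _, _, _, _, h1, _, _⟩ := halfPlane_isBigO_basic hδ
  have h2T : (psi2 + (π * I) • xi2) =O[𝓟 (halfPlane δ)] fun τ : ℍ => ‖(τ : ℂ)‖ := by
    have hx : xi2 =O[𝓟 (halfPlane δ)] fun τ : ℍ => ‖(τ : ℂ)‖ := by simpa using h1.mul hxi2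
    exact (hψ2.add (hx.const_mul_left (π * I : ℂ))).congr_left fun τ => by simp [smul_eq_mul]
  have h2TS : (psi2 + (π * I) • xi2S) =O[𝓟 (halfPlane δ)] fun τ : ℍ => ‖(τ : ℂ)‖ := by
    have hx : xi2S =O[𝓟 (halfPlane δ)] fun τ : ℍ => ‖(τ : ℂ)‖ := by simpa using h1.mul hxi2S
    exact (hψ2.add (hx.const_mul_left (π * I : ℂ))).congr_left fun τ => by simp [smul_eq_mul]
  have main : ∀ {R2 R4 : ℍ → ℂ}, psi2 ∣[(2 : ℤ)] γ = R2 → psi4 ∣[(4 : ℤ)] γ = R4 →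
      R2 =O[𝓟 (halfPlane δ)] (fun τ : ℍ => ‖(τ : ℂ)‖) → R4 =O[𝓟 (halfPlane δ)] (fun τ : ℍ => ‖(τ : ℂ)‖) →
      ∃ C : ℝ, ∀ τ z : ℍ, δ ≤ τ.im → δ ≤ z.im →
        ‖(((fun σ => kernelMinus8 σ z) ∣[(4 : ℤ)] γ) τ - minus8G (psi4 ∣[(4 : ℤ)] γ) τ z) *
          (ModularForm.discriminant τ * ModularForm.discriminant z * (kleinJ τ - kleinJ z))‖
            ≤ C * (‖(τ : ℂ)‖ ^ 2 * ‖(z : ℂ)‖ ^ 2 * expDecayHalf z) := by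
    intro R2 R4 e2 e4 hR2 hR4
    obtain ⟨C, hC⟩ := minus8Kernel_sub_G_bound_416 hδ hR2 hR4
    refine ⟨C, fun τ z hτ hz => ?_⟩
    have := hC τ z hτ hz
    rw [kernelMinus8_eq_minus8Kernel, minus8Kernel_slash, e2, e4]
    exact this
  rcases hγ with rfl | rfl | rfl
  · exact main (by rw [SlashAction.slash_one]) (by rw [SlashAction.slash_one]) hψ2 hψ4
  · obtain ⟨⟨hT2, hT4⟩, _, _⟩ := psi_rows_slash
    exact main hT2 hT4 h2T h4T
  · obtain ⟨_, hS2, hS4⟩ := psi_rows_slash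
    exact main hS2 hS4 h2TS h4TS

end Literature.NumberTheory.ModularForms
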